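import Summits.BirchSwinnertonDyer.Rank1Residual.Additive.X3SemistableTwistRankZeroThreeClass
import Summits.BirchSwinnertonDyer.Rank1Residual.Additive.X4SemistableTwistRankZeroThreeClass
import Literature.NumberTheory.EllipticCurves.Wuthrich2014.ReducibleDivisibilityCyclotomicThreeOfPrime
import Literature.NumberTheory.EllipticCurves.Wuthrich2014.ReducibleMultiplicativeDivisibilityCyclotomicThreeOfPrime
import Literature.NumberTheory.EllipticCurves.Wuthrich2014.SurjectiveMultiplicativeDivisibilityCyclotomicThreeOfPrime
import Literature.NumberTheory.EllipticCurves.Kato2004.BigImageDivisibilityCyclotomicThreeOfPrime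
import HarnessLib

/-!
# X3 / X4 at `p = 3`, ranks `(0,0)`, semistable twist — the CLASS-LEVEL theorems RE-BASED on the odd-`p`
# readings (consumer migration for the retirement of the six `p = 3` readings A92/A99/A104/A105/A107/A108)

HONEST FRAMING (cell `b2b-bsdres`, run/shared/lean/b2b/bsd-rank1-residual/, verbatim in every
file): the goal of the cell is to DELETE the COMBINATION-SHAPED residual classes of the
Birch–Swinnerton-Dyer formula for ALL analytic-rank `≤ 1` elliptic curves over `ℚ` — "full BSD
formula for every rank `≤ 1` curve in class `C`" assembled STRICTLY from published theorems — so
that the rank-`≤ 1` remainder becomes exactly the CONSTRUCTION-SHAPED classes, which are TYPED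
(missing-input `Prop`s), NOT attempted. This is not "finishing BSD". The additive sub-cell (seats
additive-p1…p4) is a RESEARCH ROUTE on the construction-shaped classes X3/X4; no claim beyond the
stated classes; the labels of X3/X4 are UNCHANGED; nothing is booked by this file.

Theorems only (no definition, no named fact; seat additive-p4, gen 11). The class-level `p = 3`
theorems of gen 7 (`X3SemistableTwistRankZeroThreeClass`, `X4SemistableTwistRankZeroThreeClass`:
lines V14/V14b/V15/V16 over `K = ℚ(ζ₃)`) take as hypotheses the SIX `p = 3` reading-facts
`Wuthrich2014.charIdeal_dvd_padicLFunction_cyclotomicThree` (A92),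
`Kato2004.charIdeal_dvd_padicLFunction_cyclotomicThree_of_surjective` (A99),
`Wuthrich2014.thm16_charIdeal_dvd_{nonsplit,split}Multiplicative_cyclotomicThree` (A104/A107),
`Wuthrich2014.kato_charIdeal_dvd_{nonsplit,split}Multiplicative_cyclotomicThree_of_surjective`
(A105/A108). Gen 11 derived each of them in the kernel from its odd-`p` twin (A117/A118/A126–A129:
`…CyclotomicThreeOfPrime` bridge files). THIS FILE restates the ten class-level theorems with the
odd-`p` readings as binders (`…_of_primeFacts`), each a one-line composition with the bridges, so
that NO cell consumer needs a `p = 3` reading as an independent hypothesis any more — the literature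
seat's C167 (ii) / the referee may retire A92, A99, A104, A105, A107, A108 (debt −6 on migration).
Every other binder (Greenberg LNM 1716 Thm. 4.1 / pp. 112–113 over a number field, Greenberg–Stevens,
Milne 1972, GZK, modularity, the row data) is unchanged. Axioms standard.
-/

noncomputable section

open scoped Classical

open WeierstrassCurve Literature.NumberTheory.EllipticCurves
  Literature.NumberTheory.EllipticCurves.ModularForms
  Literature.NumberTheory.EllipticCurves.Rank1Residual
  Literature.NumberTheory.EllipticCurves.Rank1Residual.Typed
  Summit.BirchSwinnertonDyer.Rank1Residual.AdditivePotMult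

namespace Summit.BirchSwinnertonDyer.Rank1Residual.Additive

variable (V : WeierstrassCurve ℚ) [V.IsElliptic] [V.IsGloballyMinimal]
  (W : WeierstrassCurve ℚ) [W.IsElliptic] [W.IsGloballyMinimal]

/-! ### X3 (reducible `W[3]`): Wuthrich Thm. 16 readings at a general odd `p` -/

/-- **X3 at `p = 3`, class level, ranks `(0,0)`, semistable twist: the sum inequality
`ord₃ #Ш(V) + ord₃ #Ш(W) ≤ ord₃ #Ш_an(V) + ord₃ #Ш_an(W)`** — `ClassX3.exists_padicVal_shaOrder_add_le_three_of_semistableTwist`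
with the three Wuthrich Thm. 16 readings taken at a GENERAL odd `p` over `ℚ(ζ_p)` (A117, A126, A127)
and specialised to `p = 3` by the kernel bridges of gen 11.
[cite: Wuthrich2014, Thm. 16 (p. 397)] [cite: GreenbergLNM1716, Thm. 4.1 (p. 102) and §4 pp. 112–113]
[cite: Milne1972ArithmeticAV, §1 Thm. 1] -/
theorem ClassX3.exists_padicVal_shaOrder_add_le_three_of_semistableTwist_of_primeFacts
    (hW : Wuthrich2014.charIdeal_dvd_padicLFunction_cyclotomicPrime)
    (hWns : Wuthrich2014.thm16_charIdeal_dvd_nonsplitMultiplicative_cyclotomicPrime)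
    (hWs : Wuthrich2014.thm16_charIdeal_dvd_splitMultiplicative_cyclotomicPrime)
    (hGr : Greenberg1999.thm41_charValue_rankZero_numberField)
    (hGrns : Greenberg1999.thm41Analogue_charValue_rankZero_numberField)
    (hGrs : Greenberg1999.thm41Analogue_charValue_rankZero_split_baseChange)
    (hGS : greenberg_stevens V 3)
    (hMilne : Milne1972.bsdQuotient_baseChange_quadratic_anyModel)
    (hGZK : rank_eq_analyticRank_of_analyticRank_le_one) (hmod : hasEntireLFunction_rat)
    (hmodD : nonempty_modularParametrizationData)
    (hX : ClassX3 W 3) (C : VariableChange ℚ) (hC : C • V.quadraticTwist (-(3 : ℚ)) = W)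
    (hsst : V.HasGoodReductionAtPrime 3 ∨ V.HasMultiplicativeReductionAtPrime 3)
    (hrV : V.analyticRank = 0) (hrW : W.analyticRank = 0) :
    ∃ qV qW : ℚ, shaAn V = (qV : ℂ) ∧ shaAn W = (qW : ℂ) ∧
      (padicValNat 3 V.shaOrder : ℤ) + padicValNat 3 W.shaOrder ≤ padicValRat 3 qV + padicValRat 3 qW :=
  ClassX3.exists_padicVal_shaOrder_add_le_three_of_semistableTwist V W
    (Wuthrich2014.charIdeal_dvd_padicLFunction_cyclotomicThree_of_cyclotomicPrime hW)
    (Wuthrich2014.thm16_charIdeal_dvd_nonsplitMultiplicative_cyclotomicThree_of_cyclotomicPrime hWns)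
    (Wuthrich2014.thm16_charIdeal_dvd_splitMultiplicative_cyclotomicThree_of_cyclotomicPrime hWs)
    hGr hGrns hGrs hGS hMilne hGZK hmod hmodD hX C hC hsst hrV hrW

/-- **X3 at `p = 3`, class level: the typed UPPER half `Typed.MissingUpperBoundAt W 3`** on the rows
with `3 ∤ #Ш_an(V)` — `ClassX3.missingUpperBoundAt_three_of_semistableTwist` re-based on the odd-`p`
Wuthrich readings (A117, A126, A127).
[cite: Wuthrich2014, Thm. 16 (p. 397)] [cite: GreenbergLNM1716, Thm. 4.1 (p. 102) and §4 pp. 112–113] -/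
theorem ClassX3.missingUpperBoundAt_three_of_semistableTwist_of_primeFacts
    (hW : Wuthrich2014.charIdeal_dvd_padicLFunction_cyclotomicPrime)
    (hWns : Wuthrich2014.thm16_charIdeal_dvd_nonsplitMultiplicative_cyclotomicPrime)
    (hWs : Wuthrich2014.thm16_charIdeal_dvd_splitMultiplicative_cyclotomicPrime)
    (hGr : Greenberg1999.thm41_charValue_rankZero_numberField)
    (hGrns : Greenberg1999.thm41Analogue_charValue_rankZero_numberField)
    (hGrs : Greenberg1999.thm41Analogue_charValue_rankZero_split_baseChange)
    (hGS : greenberg_stevens V 3)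
    (hMilne : Milne1972.bsdQuotient_baseChange_quadratic_anyModel)
    (hGZK : rank_eq_analyticRank_of_analyticRank_le_one) (hmod : hasEntireLFunction_rat)
    (hmodD : nonempty_modularParametrizationData)
    (hX : ClassX3 W 3) (C : VariableChange ℚ) (hC : C • V.quadraticTwist (-(3 : ℚ)) = W)
    (hsst : V.HasGoodReductionAtPrime 3 ∨ V.HasMultiplicativeReductionAtPrime 3)
    (hrV : V.analyticRank = 0) (hrW : W.analyticRank = 0)
    {qV : ℚ} (hqV : shaAn V = (qV : ℂ)) (hv : padicValRat 3 qV ≤ 0) :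
    MissingUpperBoundAt W 3 :=
  ClassX3.missingUpperBoundAt_three_of_semistableTwist V W
    (Wuthrich2014.charIdeal_dvd_padicLFunction_cyclotomicThree_of_cyclotomicPrime hW)
    (Wuthrich2014.thm16_charIdeal_dvd_nonsplitMultiplicative_cyclotomicThree_of_cyclotomicPrime hWns)
    (Wuthrich2014.thm16_charIdeal_dvd_splitMultiplicative_cyclotomicThree_of_cyclotomicPrime hWs)
    hGr hGrns hGrs hGS hMilne hGZK hmod hmodD hX C hC hsst hrV hrW hqV hv

/-- **X3 at `p = 3`, class level: `BSD(W,3) ∧ BSD(V,3)` on the doubly-unit rank-`(0,0)` rows** —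
`ClassX3.bsdp_three_of_semistableTwist_of_shaAn_units` re-based on the odd-`p` Wuthrich readings
(A117, A126, A127). Census unchanged (243 of the 247 CORE-open rows, hyp cyc3 two-engine, `N < 2·10⁴`).
Labels UNCHANGED; nothing booked.
[cite: Wuthrich2014, Thm. 16 (p. 397)] [cite: GreenbergLNM1716, Thm. 4.1 (p. 102) and §4 pp. 112–113]
[cite: Milne1972ArithmeticAV, §1 Thm. 1] [cite: Miller2011LMS, §1 and Def. 1.1] -/
theorem ClassX3.bsdp_three_of_semistableTwist_of_shaAn_units_of_primeFacts
    (hW : Wuthrich2014.charIdeal_dvd_padicLFunction_cyclotomicPrime)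
    (hWns : Wuthrich2014.thm16_charIdeal_dvd_nonsplitMultiplicative_cyclotomicPrime)
    (hWs : Wuthrich2014.thm16_charIdeal_dvd_splitMultiplicative_cyclotomicPrime)
    (hGr : Greenberg1999.thm41_charValue_rankZero_numberField)
    (hGrns : Greenberg1999.thm41Analogue_charValue_rankZero_numberField)
    (hGrs : Greenberg1999.thm41Analogue_charValue_rankZero_split_baseChange)
    (hGS : greenberg_stevens V 3)
    (hMilne : Milne1972.bsdQuotient_baseChange_quadratic_anyModel)
    (hGZK : rank_eq_analyticRank_of_analyticRank_le_one) (hmod : hasEntireLFunction_rat)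
    (hmodD : nonempty_modularParametrizationData)
    (hX : ClassX3 W 3) (C : VariableChange ℚ) (hC : C • V.quadraticTwist (-(3 : ℚ)) = W)
    (hsst : V.HasGoodReductionAtPrime 3 ∨ V.HasMultiplicativeReductionAtPrime 3)
    (hrV : V.analyticRank = 0) (hrW : W.analyticRank = 0)
    {qV qW : ℚ} (hqV : shaAn V = (qV : ℂ)) (hqW : shaAn W = (qW : ℂ))
    (hvV : padicValRat 3 qV = 0) (hvW : padicValRat 3 qW = 0) : BSDp W 3 ∧ BSDp V 3 :=
  ClassX3.bsdp_three_of_semistableTwist_of_shaAn_units V W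
    (Wuthrich2014.charIdeal_dvd_padicLFunction_cyclotomicThree_of_cyclotomicPrime hW)
    (Wuthrich2014.thm16_charIdeal_dvd_nonsplitMultiplicative_cyclotomicThree_of_cyclotomicPrime hWns)
    (Wuthrich2014.thm16_charIdeal_dvd_splitMultiplicative_cyclotomicThree_of_cyclotomicPrime hWs)
    hGr hGrns hGrs hGS hMilne hGZK hmod hmodD hX C hC hsst hrV hrW hqV hqW hvV hvW

/-- **X3♯(M) at `p = 3`, ranks `(0,0)`: the sum inequality** — `ClassX3M.exists_padicVal_shaOrder_add_le_three`
re-based on the odd-`p` multiplicative Wuthrich readings (A126, A127).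
[cite: Wuthrich2014, Thm. 16 (p. 397)] [cite: GreenbergLNM1716, §4 pp. 112–113] [cite: SilvermanATAEC1994, V.5.3] -/
theorem ClassX3M.exists_padicVal_shaOrder_add_le_three_of_primeFacts
    (hWns : Wuthrich2014.thm16_charIdeal_dvd_nonsplitMultiplicative_cyclotomicPrime)
    (hWs : Wuthrich2014.thm16_charIdeal_dvd_splitMultiplicative_cyclotomicPrime)
    (hGrns : Greenberg1999.thm41Analogue_charValue_rankZero_numberField)
    (hGrs : Greenberg1999.thm41Analogue_charValue_rankZero_split_baseChange)
    (hGS : greenberg_stevens V 3)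
    (hMilne : Milne1972.bsdQuotient_baseChange_quadratic_anyModel)
    (hGZK : rank_eq_analyticRank_of_analyticRank_le_one) (hmod : hasEntireLFunction_rat)
    (hmodD : nonempty_modularParametrizationData)
    (hX : ClassX3M W 3) (C : VariableChange ℚ) (hC : C • V.quadraticTwist (-(3 : ℚ)) = W)
    (hrV : V.analyticRank = 0) (hrW : W.analyticRank = 0) :
    ∃ qV qW : ℚ, shaAn V = (qV : ℂ) ∧ shaAn W = (qW : ℂ) ∧
      (padicValNat 3 V.shaOrder : ℤ) + padicValNat 3 W.shaOrder ≤ padicValRat 3 qV + padicValRat 3 qW :=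
  ClassX3M.exists_padicVal_shaOrder_add_le_three V W
    (Wuthrich2014.thm16_charIdeal_dvd_nonsplitMultiplicative_cyclotomicThree_of_cyclotomicPrime hWns)
    (Wuthrich2014.thm16_charIdeal_dvd_splitMultiplicative_cyclotomicThree_of_cyclotomicPrime hWs)
    hGrns hGrs hGS hMilne hGZK hmod hmodD hX C hC hrV hrW

/-- **X3♯(M) at `p = 3`: `BSD(W,3) ∧ BSD(V,3)` on the doubly-unit rank-`(0,0)` rows** —
`ClassX3M.bsdp_three_of_shaAn_units` re-based on the odd-`p` multiplicative Wuthrich readings (A126,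
A127). Labels UNCHANGED; nothing booked.
[cite: Wuthrich2014, Thm. 16 (p. 397)] [cite: GreenbergLNM1716, §4 pp. 112–113] [cite: Miller2011LMS, §1 and Def. 1.1] -/
theorem ClassX3M.bsdp_three_of_shaAn_units_of_primeFacts
    (hWns : Wuthrich2014.thm16_charIdeal_dvd_nonsplitMultiplicative_cyclotomicPrime)
    (hWs : Wuthrich2014.thm16_charIdeal_dvd_splitMultiplicative_cyclotomicPrime)
    (hGrns : Greenberg1999.thm41Analogue_charValue_rankZero_numberField)
    (hGrs : Greenberg1999.thm41Analogue_charValue_rankZero_split_baseChange)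
    (hGS : greenberg_stevens V 3)
    (hMilne : Milne1972.bsdQuotient_baseChange_quadratic_anyModel)
    (hGZK : rank_eq_analyticRank_of_analyticRank_le_one) (hmod : hasEntireLFunction_rat)
    (hmodD : nonempty_modularParametrizationData)
    (hX : ClassX3M W 3) (C : VariableChange ℚ) (hC : C • V.quadraticTwist (-(3 : ℚ)) = W)
    (hrV : V.analyticRank = 0) (hrW : W.analyticRank = 0)
    {qV qW : ℚ} (hqV : shaAn V = (qV : ℂ)) (hqW : shaAn W = (qW : ℂ))
    (hvV : padicValRat 3 qV = 0) (hvW : padicValRat 3 qW = 0) : BSDp W 3 ∧ BSDp V 3 :=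
  ClassX3M.bsdp_three_of_shaAn_units V W
    (Wuthrich2014.thm16_charIdeal_dvd_nonsplitMultiplicative_cyclotomicThree_of_cyclotomicPrime hWns)
    (Wuthrich2014.thm16_charIdeal_dvd_splitMultiplicative_cyclotomicThree_of_cyclotomicPrime hWs)
    hGrns hGrs hGS hMilne hGZK hmod hmodD hX C hC hrV hrW hqV hqW hvV hvW

/-! ### X4 (irreducible `W[3]`, `surj(3) ∧ ram(3)`): Kato-side readings at a general odd `p` -/

/-- **X4 at `p = 3`, class level, ranks `(0,0)`, ordinary-semistable twist: the sum inequality** —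
`ClassX4.exists_padicVal_shaOrder_add_le_three_of_ordSemistableTwist` with Kato Thm. 17.4 (3) and the
Wuthrich Thm. 3 / Cor. 19 attributions taken at a GENERAL odd `p` over `ℚ(ζ_p)` (A118, A128, A129) and
specialised to `p = 3` by the kernel bridges of gen 11.
[cite: Kato2004Asterisque, Thm. 17.4 (3) (p. 273)] [cite: Wuthrich2014, Thm. 3 (p. 383) and Cor. 19 (pp. 398–399)]
[cite: GreenbergLNM1716, Thm. 4.1 (p. 102) and §4 pp. 112–113] [cite: Milne1972ArithmeticAV, §1 Thm. 1] -/
theorem ClassX4.exists_padicVal_shaOrder_add_le_three_of_ordSemistableTwist_of_primeFacts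
    (hK : Kato2004.charIdeal_dvd_padicLFunction_cyclotomicPrime_of_surjective)
    (hKns : Wuthrich2014.kato_charIdeal_dvd_nonsplitMultiplicative_cyclotomicPrime_of_surjective)
    (hKs : Wuthrich2014.kato_charIdeal_dvd_splitMultiplicative_cyclotomicPrime_of_surjective)
    (hGr : Greenberg1999.thm41_charValue_rankZero_numberField)
    (hGrns : Greenberg1999.thm41Analogue_charValue_rankZero_numberField)
    (hGrs : Greenberg1999.thm41Analogue_charValue_rankZero_split_baseChange)
    (hGS : greenberg_stevens V 3)
    (hMilne : Milne1972.bsdQuotient_baseChange_quadratic_anyModel)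
    (hGZK : rank_eq_analyticRank_of_analyticRank_le_one) (hmod : hasEntireLFunction_rat)
    (hmodD : nonempty_modularParametrizationData)
    (hX : ClassX4 W 3) (hsurj : Surj W 3) (hram : Ram W 3)
    (C : VariableChange ℚ) (hC : C • V.quadraticTwist (-(3 : ℚ)) = W)
    (hsst : IsOrdinaryAt V 3 ∨ V.HasMultiplicativeReductionAtPrime 3)
    (hrV : V.analyticRank = 0) (hrW : W.analyticRank = 0) :
    ∃ qV qW : ℚ, shaAn V = (qV : ℂ) ∧ shaAn W = (qW : ℂ) ∧
      (padicValNat 3 V.shaOrder : ℤ) + padicValNat 3 W.shaOrder ≤ padicValRat 3 qV + padicValRat 3 qW :=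
  ClassX4.exists_padicVal_shaOrder_add_le_three_of_ordSemistableTwist V W
    (Kato2004.charIdeal_dvd_padicLFunction_cyclotomicThree_of_surjective_of_cyclotomicPrime hK)
    (Wuthrich2014.kato_charIdeal_dvd_nonsplitMultiplicative_cyclotomicThree_of_surjective_of_cyclotomicPrime
      hKns)
    (Wuthrich2014.kato_charIdeal_dvd_splitMultiplicative_cyclotomicThree_of_surjective_of_cyclotomicPrime
      hKs)
    hGr hGrns hGrs hGS hMilne hGZK hmod hmodD hX hsurj hram C hC hsst hrV hrW

/-- **X4 at `p = 3`, class level: the typed UPPER half `Typed.MissingUpperBoundAt W 3`** on the rows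
with `3 ∤ #Ш_an(V)` — `ClassX4.missingUpperBoundAt_three_of_ordSemistableTwist` re-based on the odd-`p`
Kato-side readings (A118, A128, A129).
[cite: Kato2004Asterisque, Thm. 17.4 (3) (p. 273)] [cite: Wuthrich2014, Thm. 3 (p. 383) and Cor. 19 (pp. 398–399)]
[cite: GreenbergLNM1716, Thm. 4.1 (p. 102) and §4 pp. 112–113] -/
theorem ClassX4.missingUpperBoundAt_three_of_ordSemistableTwist_of_primeFacts
    (hK : Kato2004.charIdeal_dvd_padicLFunction_cyclotomicPrime_of_surjective)
    (hKns : Wuthrich2014.kato_charIdeal_dvd_nonsplitMultiplicative_cyclotomicPrime_of_surjective)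
    (hKs : Wuthrich2014.kato_charIdeal_dvd_splitMultiplicative_cyclotomicPrime_of_surjective)
    (hGr : Greenberg1999.thm41_charValue_rankZero_numberField)
    (hGrns : Greenberg1999.thm41Analogue_charValue_rankZero_numberField)
    (hGrs : Greenberg1999.thm41Analogue_charValue_rankZero_split_baseChange)
    (hGS : greenberg_stevens V 3)
    (hMilne : Milne1972.bsdQuotient_baseChange_quadratic_anyModel)
    (hGZK : rank_eq_analyticRank_of_analyticRank_le_one) (hmod : hasEntireLFunction_rat)
    (hmodD : nonempty_modularParametrizationData)
    (hX : ClassX4 W 3) (hsurj : Surj W 3) (hram : Ram W 3)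
    (C : VariableChange ℚ) (hC : C • V.quadraticTwist (-(3 : ℚ)) = W)
    (hsst : IsOrdinaryAt V 3 ∨ V.HasMultiplicativeReductionAtPrime 3)
    (hrV : V.analyticRank = 0) (hrW : W.analyticRank = 0)
    {qV : ℚ} (hqV : shaAn V = (qV : ℂ)) (hv : padicValRat 3 qV ≤ 0) :
    MissingUpperBoundAt W 3 :=
  ClassX4.missingUpperBoundAt_three_of_ordSemistableTwist V W
    (Kato2004.charIdeal_dvd_padicLFunction_cyclotomicThree_of_surjective_of_cyclotomicPrime hK)
    (Wuthrich2014.kato_charIdeal_dvd_nonsplitMultiplicative_cyclotomicThree_of_surjective_of_cyclotomicPrime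
      hKns)
    (Wuthrich2014.kato_charIdeal_dvd_splitMultiplicative_cyclotomicThree_of_surjective_of_cyclotomicPrime
      hKs)
    hGr hGrns hGrs hGS hMilne hGZK hmod hmodD hX hsurj hram C hC hsst hrV hrW hqV hv

/-- **X4 at `p = 3`, class level: `BSD(W,3) ∧ BSD(V,3)` on the doubly-unit rank-`(0,0)` rows with
`surj(3) ∧ ram(3)`** — `ClassX4.bsdp_three_of_ordSemistableTwist_of_shaAn_units` re-based on the odd-`p`
Kato-side readings (A118, A128, A129). Census unchanged (hyp cyc3 two-engine, `N < 2·10⁴`). Labels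
UNCHANGED; nothing booked.
[cite: Kato2004Asterisque, Thm. 17.4 (3) (p. 273)] [cite: Wuthrich2014, Thm. 3 (p. 383) and Cor. 19 (pp. 398–399)]
[cite: GreenbergLNM1716, Thm. 4.1 (p. 102) and §4 pp. 112–113] [cite: Miller2011LMS, §1 and Def. 1.1] -/
theorem ClassX4.bsdp_three_of_ordSemistableTwist_of_shaAn_units_of_primeFacts
    (hK : Kato2004.charIdeal_dvd_padicLFunction_cyclotomicPrime_of_surjective)
    (hKns : Wuthrich2014.kato_charIdeal_dvd_nonsplitMultiplicative_cyclotomicPrime_of_surjective)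
    (hKs : Wuthrich2014.kato_charIdeal_dvd_splitMultiplicative_cyclotomicPrime_of_surjective)
    (hGr : Greenberg1999.thm41_charValue_rankZero_numberField)
    (hGrns : Greenberg1999.thm41Analogue_charValue_rankZero_numberField)
    (hGrs : Greenberg1999.thm41Analogue_charValue_rankZero_split_baseChange)
    (hGS : greenberg_stevens V 3)
    (hMilne : Milne1972.bsdQuotient_baseChange_quadratic_anyModel)
    (hGZK : rank_eq_analyticRank_of_analyticRank_le_one) (hmod : hasEntireLFunction_rat)
    (hmodD : nonempty_modularParametrizationData)
    (hX : ClassX4 W 3) (hsurj : Surj W 3) (hram : Ram W 3)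
    (C : VariableChange ℚ) (hC : C • V.quadraticTwist (-(3 : ℚ)) = W)
    (hsst : IsOrdinaryAt V 3 ∨ V.HasMultiplicativeReductionAtPrime 3)
    (hrV : V.analyticRank = 0) (hrW : W.analyticRank = 0)
    {qV qW : ℚ} (hqV : shaAn V = (qV : ℂ)) (hqW : shaAn W = (qW : ℂ))
    (hvV : padicValRat 3 qV = 0) (hvW : padicValRat 3 qW = 0) : BSDp W 3 ∧ BSDp V 3 :=
  ClassX4.bsdp_three_of_ordSemistableTwist_of_shaAn_units V W
    (Kato2004.charIdeal_dvd_padicLFunction_cyclotomicThree_of_surjective_of_cyclotomicPrime hK)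
    (Wuthrich2014.kato_charIdeal_dvd_nonsplitMultiplicative_cyclotomicThree_of_surjective_of_cyclotomicPrime
      hKns)
    (Wuthrich2014.kato_charIdeal_dvd_splitMultiplicative_cyclotomicThree_of_surjective_of_cyclotomicPrime
      hKs)
    hGr hGrns hGrs hGS hMilne hGZK hmod hmodD hX hsurj hram C hC hsst hrV hrW hqV hqW hvV hvW

/-- **X4(M) at `p = 3`, ranks `(0,0)`: the sum inequality** — `ClassX4M.exists_padicVal_shaOrder_add_le_three`
re-based on the odd-`p` surjective-multiplicative readings (A128, A129).
[cite: Wuthrich2014, Thm. 3 (p. 383) and Cor. 19 (pp. 398–399)] [cite: GreenbergLNM1716, §4 pp. 112–113]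
[cite: SilvermanATAEC1994, V.5.3] -/
theorem ClassX4M.exists_padicVal_shaOrder_add_le_three_of_primeFacts
    (hKns : Wuthrich2014.kato_charIdeal_dvd_nonsplitMultiplicative_cyclotomicPrime_of_surjective)
    (hKs : Wuthrich2014.kato_charIdeal_dvd_splitMultiplicative_cyclotomicPrime_of_surjective)
    (hGrns : Greenberg1999.thm41Analogue_charValue_rankZero_numberField)
    (hGrs : Greenberg1999.thm41Analogue_charValue_rankZero_split_baseChange)
    (hGS : greenberg_stevens V 3)
    (hMilne : Milne1972.bsdQuotient_baseChange_quadratic_anyModel)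
    (hGZK : rank_eq_analyticRank_of_analyticRank_le_one) (hmod : hasEntireLFunction_rat)
    (hmodD : nonempty_modularParametrizationData)
    (hX : ClassX4M W 3) (hsurj : Surj W 3) (hram : Ram W 3)
    (C : VariableChange ℚ) (hC : C • V.quadraticTwist (-(3 : ℚ)) = W)
    (hrV : V.analyticRank = 0) (hrW : W.analyticRank = 0) :
    ∃ qV qW : ℚ, shaAn V = (qV : ℂ) ∧ shaAn W = (qW : ℂ) ∧
      (padicValNat 3 V.shaOrder : ℤ) + padicValNat 3 W.shaOrder ≤ padicValRat 3 qV + padicValRat 3 qW :=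
  ClassX4M.exists_padicVal_shaOrder_add_le_three V W
    (Wuthrich2014.kato_charIdeal_dvd_nonsplitMultiplicative_cyclotomicThree_of_surjective_of_cyclotomicPrime
      hKns)
    (Wuthrich2014.kato_charIdeal_dvd_splitMultiplicative_cyclotomicThree_of_surjective_of_cyclotomicPrime
      hKs)
    hGrns hGrs hGS hMilne hGZK hmod hmodD hX hsurj hram C hC hrV hrW

/-- **X4(M) at `p = 3`: `BSD(W,3) ∧ BSD(V,3)` on the doubly-unit rank-`(0,0)` rows with
`surj(3) ∧ ram(3)`** — `ClassX4M.bsdp_three_of_shaAn_units` re-based on the odd-`p`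
surjective-multiplicative readings (A128, A129). Labels UNCHANGED; nothing booked.
[cite: Wuthrich2014, Thm. 3 (p. 383) and Cor. 19 (pp. 398–399)] [cite: GreenbergLNM1716, §4 pp. 112–113]
[cite: Miller2011LMS, §1 and Def. 1.1] -/
theorem ClassX4M.bsdp_three_of_shaAn_units_of_primeFacts
    (hKns : Wuthrich2014.kato_charIdeal_dvd_nonsplitMultiplicative_cyclotomicPrime_of_surjective)
    (hKs : Wuthrich2014.kato_charIdeal_dvd_splitMultiplicative_cyclotomicPrime_of_surjective)
    (hGrns : Greenberg1999.thm41Analogue_charValue_rankZero_numberField)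
    (hGrs : Greenberg1999.thm41Analogue_charValue_rankZero_split_baseChange)
    (hGS : greenberg_stevens V 3)
    (hMilne : Milne1972.bsdQuotient_baseChange_quadratic_anyModel)
    (hGZK : rank_eq_analyticRank_of_analyticRank_le_one) (hmod : hasEntireLFunction_rat)
    (hmodD : nonempty_modularParametrizationData)
    (hX : ClassX4M W 3) (hsurj : Surj W 3) (hram : Ram W 3)
    (C : VariableChange ℚ) (hC : C • V.quadraticTwist (-(3 : ℚ)) = W)
    (hrV : V.analyticRank = 0) (hrW : W.analyticRank = 0)
    {qV qW : ℚ} (hqV : shaAn V = (qV : ℂ)) (hqW : shaAn W = (qW : ℂ))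
    (hvV : padicValRat 3 qV = 0) (hvW : padicValRat 3 qW = 0) : BSDp W 3 ∧ BSDp V 3 :=
  ClassX4M.bsdp_three_of_shaAn_units V W
    (Wuthrich2014.kato_charIdeal_dvd_nonsplitMultiplicative_cyclotomicThree_of_surjective_of_cyclotomicPrime
      hKns)
    (Wuthrich2014.kato_charIdeal_dvd_splitMultiplicative_cyclotomicThree_of_surjective_of_cyclotomicPrime
      hKs)
    hGrns hGrs hGS hMilne hGZK hmod hmodD hX hsurj hram C hC hrV hrW hqV hqW hvV hvW

end Summit.BirchSwinnertonDyer.Rank1Residual.Additive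

end
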